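import Mathlib
import Literature.Computability.MetaComplexity.SmolenskyDimensionBound

/-!
# Reed–Muller codes of low degrees are orthogonal

Reed–Muller codes `RM(k,n)` and `RM(k',n)` are orthogonal for `k + k' + 1 ≤ n` (the easy half of
`RM(k,n)^⊥ = RM(n−k−1,n)`, MacWilliams–Sloane Ch. 13 §3 / Carlet 2020 §4.1): for
`f ∈ lowDeg (ZMod 2) n k` and `g ∈ lowDeg (ZMod 2) n k'` (Smolensky's degree filtration, the span
of the multilinear monomials `x_S`, `|S| ≤ k`, as functions on the cube `{0,1}ⁿ`) the dot product
`Σ_b f(b) g(b)` vanishes in `𝔽₂`. Proof: `f · g ∈ lowDeg (k + k')` with `k + k' < n`, and every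
`h ∈ lowDeg d` with `d < n` has `Σ_b h(b) = 0` — by linearity it suffices to treat a monomial
`x_U`, `|U| < n`, whose sum over the cube counts the `2^{n−|U|}` points `b` with `bᵢ = 1` on `U`,
an even number (flipping a free coordinate `i ∉ U` is a fixed-point-free involution of the cube
preserving `x_U`). Wave-3 support of line Sketch/LAR (duality of annihilator ranks), crux
stmt-QuantumAdvantage-1392.
-/

namespace Summit.QuantumAdvantage.DigitPolyUniformity.SketchLAR

open Finset Module
open Literature.Computability.MetaComplexity.Smolensky (CubeFn mono lowDeg)

namespace LowDegOrth

/-- Changing a coordinate outside `U` does not change the monomial `x_U`. [folklore] -/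
theorem mono_update_of_not_mem {F : Type*} [Field F] {n : ℕ} {U : Finset (Fin n)} {i : Fin n}
    (hi : i ∉ U) (b : Fin n → Bool) (c : Bool) :
    mono F U (Function.update b i c) = mono F U b := by
  simp only [Literature.Computability.MetaComplexity.Smolensky.mono]
  refine Finset.prod_congr rfl fun j hj => ?_
  rw [Function.update_of_ne (ne_of_mem_of_not_mem hj hi)]

/-- Over `𝔽₂` a monomial `x_U` with `|U| < n` sums to zero over the cube `{0,1}ⁿ`: the number
`2^{n-|U|}` of points `b` with `bᵢ = 1` for all `i ∈ U` is even (flip a free coordinate `i ∉ U`).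
[folklore] -/
theorem sum_mono_eq_zero {n : ℕ} {U : Finset (Fin n)} (hU : U.card < n) :
    ∑ b : Fin n → Bool, mono (ZMod 2) U b = 0 := by
  -- a free coordinate `i ∉ U`
  obtain ⟨i, -, hi⟩ : ∃ i, i ∈ (univ : Finset (Fin n)) ∧ i ∉ U :=
    Finset.exists_mem_notMem_of_card_lt_card (by rwa [Finset.card_univ, Fintype.card_fin])
  have h2 : ∀ x : ZMod 2, x + x = 0 := by decide
  refine Finset.sum_ninvolution (fun b => Function.update b i (!b i)) (fun b => ?_)
    (fun b _ => ?_) (fun b => Finset.mem_univ _) (fun b => ?_)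
  · rw [mono_update_of_not_mem hi, h2]
  · intro h
    have h' := congrFun h i
    rw [Function.update_self] at h'
    exact Bool.not_ne_self _ h'
  · rw [Function.update_self, Function.update_idem, Bool.not_not, Function.update_eq_self]

/-- Over `𝔽₂` every `h ∈ lowDeg d` with `d < n` (a polynomial of degree `< n` on the cube) sums
to zero over the cube. [folklore] -/
theorem sum_eq_zero_of_mem_lowDeg {n d : ℕ} (hd : d < n) {h : CubeFn (ZMod 2) n}
    (hh : h ∈ lowDeg (ZMod 2) n d) : ∑ b : Fin n → Bool, h b = 0 := by
  rw [Literature.Computability.MetaComplexity.Smolensky.lowDeg_eq_span] at hh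
  induction hh using Submodule.span_induction with
  | mem x hx =>
    obtain ⟨⟨U, hU⟩, rfl⟩ := hx
    exact sum_mono_eq_zero (hU.trans_lt hd)
  | zero => simp
  | add x y _ _ hx hy =>
    simp only [Pi.add_apply]
    rw [Finset.sum_add_distrib, hx, hy, add_zero]
  | smul c x _ hx =>
    simp only [Pi.smul_apply, smul_eq_mul]
    rw [← Finset.mul_sum, hx, mul_zero]

end LowDegOrth

/-- **Reed–Muller codes `RM(k,n)` and `RM(k',n)` are orthogonal for `k + k' + 1 ≤ n`**: for
`f ∈ lowDeg (ZMod 2) n k` and `g ∈ lowDeg (ZMod 2) n k'` the dot product `Σ_b f(b) g(b)` over the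
cube vanishes in `𝔽₂` (`f g` has degree `≤ k + k' < n`). The easy inclusion of the duality
`RM(k,n)^⊥ = RM(n-k-1,n)`. [folklore] -/
theorem stub_lowDeg_orth {n k k' : ℕ} (hkk' : k + k' + 1 ≤ n) (f g : CubeFn (ZMod 2) n)
    (hf : f ∈ lowDeg (ZMod 2) n k) (hg : g ∈ lowDeg (ZMod 2) n k') :
    ∑ b : Fin n → Bool, f b * g b = 0 :=
  LowDegOrth.sum_eq_zero_of_mem_lowDeg (d := k + k') (by omega)
    (Literature.Computability.MetaComplexity.Smolensky.mul_mem_lowDeg_add hf hg)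

end Summit.QuantumAdvantage.DigitPolyUniformity.SketchLAR
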